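import Summits.HubbardSuperconductivity.HubbardSuperconductivity.Theorems.LevyLogBootstrapDressHalfFilledStubPlaquetteDictionary
import HarnessLib

/-!
# Route `PolyaSchurPairBoson`, crux `DressAnyFilling` (stmt-HubbardSuperconductivity-10291): the registered stub
# `stub_plaquetteDictionary` of its skeleton `Cruxes/DressAnyFilling/Lines/birth.lean`, BY NAME

The birth skeletons of the two dressing cruxes `DressHalfFilled` (stmt-8148) and `DressAnyFilling` (stmt-10291) share the
statement abbreviations `PlaquetteData U`, `PlaquetteDictionary U` VERBATIM and the same stub 2,
`stub_plaquetteDictionary : ∀ U : ℝ, 0 < U → PlaquetteData U → PlaquetteDictionary U` ("so one certificate/dictionary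
proof serves both cruxes", skeleton registrar 2026-08-17). The abbreviations and the proof are landed in
`…Theorems.LevyLogBootstrap` (`…DressHalfFilledStubPlaquetteDictionary`: the dictionary `Φ = TorusPlaquette.dictionaryMap M U`,
clauses (a)–(e), the kernel table from the (W4) clauses of the data — no `U`-window); this file states the stub of the
`DressAnyFilling` skeleton by name in the sister route's namespace and proves it by that theorem.

HONEST LABEL: closes ONE registered stub (stub 2 of 3) of the birth line of `DressAnyFilling`; its stub 1 (plaquette data at
some `U`) and stub 3 (dressing stability — the open statement) remain; no crux and no summit statement is proved.

References: W.-F. Tsai, S. A. Kivelson, PRB 73 (2006) 214510, App. A (A1) [TsaiKivelson2006]; H. Yao, W.-F. Tsai,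
S. A. Kivelson, PRB 76 (2007) 161104(R), eq. (2) [YaoTsaiKivelson2007]. No definition and no named fact is introduced.
-/

set_option linter.dupNamespace false

noncomputable section

namespace Summit.HubbardSuperconductivity.HubbardSuperconductivity.Theorems.PolyaSchurPairBoson

open Summit.HubbardSuperconductivity.HubbardSuperconductivity.Theorems.LevyLogBootstrap (PlaquetteData PlaquetteDictionary)

/-- **Registered stub `stub_plaquetteDictionary` of `Cruxes/DressAnyFilling/Lines/birth.lean`, BY NAME, signature
verbatim**: at every coupling carrying the plaquette data, the plaquette-boson dictionary to second order holds
(`…Theorems.LevyLogBootstrap.stub_plaquetteDictionary`, same abbreviations). [cite: TsaiKivelson2006, App. A (A1)] -/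
theorem stub_plaquetteDictionary :
    ∀ U : ℝ, 0 < U → PlaquetteData U → PlaquetteDictionary U :=
  Summit.HubbardSuperconductivity.HubbardSuperconductivity.Theorems.LevyLogBootstrap.stub_plaquetteDictionary

end Summit.HubbardSuperconductivity.HubbardSuperconductivity.Theorems.PolyaSchurPairBoson

end
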